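import Summits.PneNP.PneNP.Theses.ExpanderLinearGenerators
import Summits.PneNP.PneNP.Theorems.ExpanderLinearGeneratorsConjAxiomDepthFloor
import Literature.Computability.MetaComplexity.LinearMapResolutionWidthProofs

/-!
# The depth floor of `LinearGeneratorDepthFregeHard` (route ExpanderLinearGenerators, crux 3)

Second helper file for item stmt-PneNP-11443
(`Summit.PneNP.PneNP.Theses.ExpanderLinearGenerators.LinearGeneratorDepthFregeHard`,
Krajíček's Problem 19.4.5 in universal-expander form), on top of
`ExpanderLinearGeneratorsConjAxiomDepthFloor.lean` (`seven_le_of_isDepthProofOf_neg_ofCNF`).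

* `exists_neg_clause_tail` — for `ℓ ≥ 1`, `r ≥ 2`, the XOR-CNF `sumEncoding 1 E` of an `ℓ`-sparse
  `(r, 3/4·ℓ)`-boundary-expanding unsolvable system over `𝔽₂` is `C :: φ` with a negative literal
  in `φ` (small row sets are solvable, so `m ≥ 3`; `ℓ = 1` is contradictory; rows `0`, `1` have
  supports `≥ 2` and distinct, and each contributes a clause with a negative literal).
* `not_isDepthProofOf_of_le_six` — hence it has NO `textbookFrege` proof of alternation depth
  `≤ 6`.
* `linearGeneratorDepthFregeHard_depth_le_six` — the `d ≤ 6` slice of the crux (with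
  `N = ⌈2^{1/(1-δ)}⌉`, vacuously), and
  `linearGeneratorDepthFregeHard_iff_seven_le` — the crux is equivalent to its restriction to
  depths `d ≥ 7`: its content starts at `d = 7`, not at `d = 4 = altDepth (¬ ofCNF _)`.
-/

namespace Summit.PneNP.PneNP.Theorems

set_option linter.dupNamespace false -- `Summit.PneNP.PneNP.…`: summit = sub-problem (D-0017)

open Literature.Computability.Complexity Literature.Computability.Complexity.PropForm
open Literature.Computability.MetaComplexity

/-! ### Part 4. The XOR-CNF of an expanding unsolvable system over `𝔽₂` -/

section System

variable {n m : ℕ} (E : Fin m → LinEqMod 2 n)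

/-- In `𝔽₂`, non-zero means `1`. [folklore] -/
theorem zmod_two_eq_one_of_ne_zero {a : ZMod 2} (h : a ≠ 0) : a = 1 := by
  revert a; decide

/-- In `𝔽₂`, not `1` means `0`. [folklore] -/
theorem zmod_two_eq_zero_of_ne_one {a : ZMod 2} (h : a ≠ 1) : a = 0 := by
  revert a; decide

/-- Over `𝔽₂` the coefficients on the support are `1`. [folklore] -/
theorem coeff_eq_one_of_mem_supp {e : LinEqMod 2 n} {j : Fin n} (hj : j ∈ e.supp) : e.1 j = 1 :=
  zmod_two_eq_one_of_ne_zero (by simpa [LinEqMod.supp] using hj)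

/-- Under the `B = 1` encoding, `j ∈ supp e` iff the Boolean variable `j` is a variable of the
encoded equation. [folklore] -/
theorem mem_supp_iff_val_mem_eqVars {e : LinEqMod 2 n} {j : Fin n} :
    j ∈ e.supp ↔ (j : ℕ) ∈ eqVars 1 e := by
  rw [mem_eqVars]
  constructor
  · intro hj
    exact ⟨j, hj, mem_encBlock.2 ⟨0, Nat.one_pos, by simp⟩⟩
  · rintro ⟨i, hi, hji⟩
    obtain ⟨k, hk, hjk⟩ := mem_encBlock.1 hji
    have hji' : (j : ℕ) = i := by omega
    rwa [Fin.ext hji']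

/-- **A row of support `≥ 2` contributes a clause with a negative literal**, and that clause lists
exactly the variables of the row. (Take two support elements `j₁ ≠ j₂`; one of the indicator
assignments of `{j₁}` and `{j₁, j₂}` violates the row, and the clause it falsifies contains
`¬x_{j₁}`.) [folklore] -/
theorem exists_neg_clause_of_two_le_card {e : LinEqMod 2 n} (he : 2 ≤ e.supp.card) :
    ∃ D ∈ equationCNF 1 e, (∃ l ∈ D, l.2 = false) ∧ D.map Prod.fst = eqVars 1 e := by
  obtain ⟨j₁, hj₁, j₂, hj₂, hne⟩ := Finset.one_lt_card.1 he
  have ha₁ : e.1 j₁ = 1 := coeff_eq_one_of_mem_supp hj₁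
  have ha₂ : e.1 j₂ = 1 := coeff_eq_one_of_mem_supp hj₂
  -- the value of the row under the indicator assignment of `{j₁}` and of `{j₁, j₂}`
  have hsum₁ : ∑ j, e.1 j * blockVals 2 1 n (fun v => decide (v = (j₁ : ℕ))) j = 1 := by
    have hval : ∀ j : Fin n,
        blockVals 2 1 n (fun v => decide (v = (j₁ : ℕ))) j = if j = j₁ then 1 else 0 := by
      intro j
      rw [blockVals_two_one_apply]
      simp [Fin.val_inj]
    simp_rw [hval, mul_ite, mul_one, mul_zero, Finset.sum_ite_eq', Finset.mem_univ, if_true, ha₁]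
  have hsum₂ : ∑ j, e.1 j * blockVals 2 1 n (fun v => decide (v = (j₁ : ℕ) ∨ v = (j₂ : ℕ))) j
      = 0 := by
    have hval : ∀ j : Fin n, blockVals 2 1 n (fun v => decide (v = (j₁ : ℕ) ∨ v = (j₂ : ℕ))) j =
        (if j = j₁ then 1 else 0) + (if j = j₂ then 1 else 0) := by
      intro j
      rw [blockVals_two_one_apply]
      by_cases h1 : j = j₁
      · subst h1
        simp [hne]
      · by_cases h2 : j = j₂
        · subst h2
          simp [h1]
        · simp [h1, h2, Fin.val_inj]
    simp_rw [hval, mul_add, Finset.sum_add_distrib, mul_ite, mul_one, mul_zero, Finset.sum_ite_eq',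
      Finset.mem_univ, if_true, ha₁, ha₂]
    decide
  -- one of them violates the row, and both make `x_{j₁}` true
  obtain ⟨σ, hσ₁, hfalse⟩ : ∃ σ : ℕ → Bool, σ j₁ = true ∧ ¬ e.Holds (blockVals 2 1 n σ) := by
    by_cases hb : e.2 = 1
    · refine ⟨fun v => decide (v = (j₁ : ℕ) ∨ v = (j₂ : ℕ)), by simp, ?_⟩
      unfold LinEqMod.Holds
      rw [hsum₂, hb]
      decide
    · refine ⟨fun v => decide (v = (j₁ : ℕ)), by simp, ?_⟩
      unfold LinEqMod.Holds
      rw [hsum₁, zmod_two_eq_zero_of_ne_one hb]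
      decide
  -- hence some clause of the encoded row is falsified by `σ`
  have heval : (equationCNF 1 e).eval σ = false := by
    rw [eval_equationCNF]
    simpa using hfalse
  obtain ⟨D, hD, hDσ⟩ : ∃ D ∈ equationCNF 1 e, D.any (Literal.eval σ) = false := by
    simpa [CNF.eval] using heval
  have hj₁V : (j₁ : ℕ) ∈ eqVars 1 e := mem_supp_iff_val_mem_eqVars.1 hj₁
  simp only [equationCNF, canonicalCNF] at hD ⊢
  obtain ⟨S, -, rfl⟩ := List.mem_map.1 hD
  refine ⟨_, hD, ?_, by simp [Function.comp_def]⟩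
  -- the falsified clause is indexed by the set of true variables, which contains `x_{j₁}`
  have hall := (any_canonicalClause_eq_false_iff σ).1 hDσ
  have hj₁S : (j₁ : ℕ) ∈ S := by
    have := hall _ hj₁V
    rw [hσ₁] at this
    simpa using this.symm
  exact ⟨((j₁ : ℕ), decide ((j₁ : ℕ) ∉ S)), List.mem_map.2 ⟨j₁, hj₁V, rfl⟩, by simp [hj₁S]⟩

variable {r : ℝ} {ℓ : ℕ}

/-- Expansion at one row: `3ℓ/4 ≤ |supp (E i)|` (for `r ≥ 1`). [folklore] -/
theorem le_card_supp_of_expander (hr : 1 ≤ r)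
    (hexp : IsBoundaryExpander (fun i => (E i).supp.map Fin.valEmbedding) r (3 / 4 * ℓ))
    (i : Fin m) : (3 / 4 * ℓ : ℝ) ≤ (E i).supp.card := by
  have h := hexp {i} (by simpa using hr)
  have hsub : (boundary (fun i => (E i).supp.map Fin.valEmbedding) {i}).card ≤ (E i).supp.card :=
    calc _ ≤ (cover (fun i => (E i).supp.map Fin.valEmbedding) {i}).card :=
          Finset.card_le_card (boundary_subset_cover _)
      _ = ((E i).supp.map Fin.valEmbedding).card := by simp [cover]
      _ = (E i).supp.card := Finset.card_map _
  have h' : ((boundary (fun i => (E i).supp.map Fin.valEmbedding) {i}).card : ℝ) ≤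
      (E i).supp.card := by exact_mod_cast hsub
  simp only [Finset.card_singleton, Nat.cast_one, mul_one] at h
  linarith

/-- Expansion at two rows: distinct rows have distinct supports (for `r ≥ 2`, `ℓ ≥ 1`): a pair
of rows with equal supports has empty boundary. [folklore] -/
theorem supp_ne_of_expander (hℓ : 1 ≤ ℓ) (hr : 2 ≤ r)
    (hexp : IsBoundaryExpander (fun i => (E i).supp.map Fin.valEmbedding) r (3 / 4 * ℓ))
    {i j : Fin m} (hij : i ≠ j) : (E i).supp ≠ (E j).supp := by
  intro heq
  have h := hexp {i, j} (by rw [Finset.card_pair hij]; exact_mod_cast hr)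
  have hbd : boundary (fun i => (E i).supp.map Fin.valEmbedding) {i, j} = ∅ := by
    refine Finset.eq_empty_of_forall_notMem fun v hv => ?_
    rw [mem_boundary] at hv
    obtain ⟨hcov, hdeg⟩ := hv
    have hvi : v ∈ (E i).supp.map Fin.valEmbedding := by
      obtain ⟨k, hk, hvk⟩ := mem_cover.1 hcov
      rcases Finset.mem_insert.1 hk with rfl | hk
      · exact hvk
      · rw [Finset.mem_singleton.1 hk] at hvk
        rwa [heq]
    have hvj : v ∈ (E j).supp.map Fin.valEmbedding := by rwa [← heq]
    have h2 : coverDegree (fun i => (E i).supp.map Fin.valEmbedding) {i, j} v = 2 := by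
      unfold coverDegree
      rw [Finset.filter_true_of_mem, Finset.card_pair hij]
      intro k hk
      rcases Finset.mem_insert.1 hk with rfl | hk
      · exact hvi
      · rw [Finset.mem_singleton.1 hk]
        exact hvj
    omega
  rw [hbd, Finset.card_empty, Finset.card_pair hij] at h
  have : (1 : ℝ) ≤ ℓ := by exact_mod_cast hℓ
  push_cast at h
  linarith

/-- A system of one-variable equations with pairwise distinct supports is solvable. [folklore] -/
theorem systemSat_of_card_supp_eq_one (hone : ∀ i, (E i).supp.card = 1)
    (hdist : ∀ i j : Fin m, i ≠ j → (E i).supp ≠ (E j).supp) : SystemSat E Finset.univ := by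
  classical
  have hx : ∀ i, ∃ x, (E i).supp = {x} := fun i => Finset.card_eq_one.1 (hone i)
  choose x hx using hx
  refine ⟨fun y => if ∃ i, x i = y ∧ (E i).2 = 1 then 1 else 0, fun i _ => ?_⟩
  unfold LinEqMod.Holds
  rw [(E i).sum_eq_sum_supp, hx i, Finset.sum_singleton,
    coeff_eq_one_of_mem_supp (by rw [hx i]; simp), one_mul]
  by_cases hb : (E i).2 = 1
  · rw [if_pos ⟨i, rfl, hb⟩, hb]
  · rw [zmod_two_eq_zero_of_ne_one hb, if_neg]
    rintro ⟨i', hi', hb'⟩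
    have : i' = i := by
      by_contra hne
      exact hdist i' i hne (by rw [hx i', hx i, hi'])
    subst this
    exact hb hb'

/-- **The tail of the XOR-CNF of an expanding unsolvable system contains a negative literal**
(for `ℓ ≥ 1`, `r ≥ 2`). Small sets of rows are solvable, so `m > r ≥ 2`; `ℓ = 1` is impossible
(one-variable rows with pairwise distinct supports are solvable); for `ℓ ≥ 2` every row has
support `≥ 2`, rows `0` and `1` each contribute a clause with a negative literal over their own
(distinct) variable sets, and one of these two distinct clauses lies in the tail. [folklore] -/
theorem exists_neg_clause_tail (hℓ : 1 ≤ ℓ) (hr : 2 ≤ r)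
    (hsparse : ∀ i, (E i).supp.card ≤ ℓ)
    (hexp : IsBoundaryExpander (fun i => (E i).supp.map Fin.valEmbedding) r (3 / 4 * ℓ))
    (hunsat : ¬ SystemSat E Finset.univ) :
    ∃ C φ, sumEncoding 1 E = C :: φ ∧ ∃ D ∈ φ, ∃ l ∈ D, l.2 = false := by
  have hc : (0 : ℝ) < 3 / 4 * ℓ := by
    have : (1 : ℝ) ≤ ℓ := by exact_mod_cast hℓ
    linarith
  -- `m > r ≥ 2`
  have hm : 2 < m := by
    by_contra hle
    push Not at hle
    obtain ⟨σ, hσ⟩ := exists_rows_hold_of_card_le E hexp hc Finset.univ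
      (by rw [Finset.card_univ, Fintype.card_fin]; exact le_trans (by exact_mod_cast hle) hr)
    exact hunsat ⟨blockVals 2 1 n σ, hσ⟩
  -- `ℓ ≥ 2`
  have hℓ2 : 2 ≤ ℓ := by
    by_contra hlt
    push Not at hlt
    obtain rfl : ℓ = 1 := by omega
    refine hunsat (systemSat_of_card_supp_eq_one E (fun i => ?_)
      fun i j hij => supp_ne_of_expander E le_rfl hr hexp hij)
    have h1 := le_card_supp_of_expander E (by linarith) hexp i
    have h2 := hsparse i
    have h3 : (0 : ℝ) < (E i).supp.card := by push_cast at h1; linarith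
    have h4 : 0 < (E i).supp.card := by exact_mod_cast h3
    omega
  -- every row has support `≥ 2`
  have hcard : ∀ i, 2 ≤ (E i).supp.card := fun i => by
    have h1 := le_card_supp_of_expander E (by linarith) hexp i
    have h2 : (2 : ℝ) ≤ ℓ := by exact_mod_cast hℓ2
    have h3 : (1 : ℝ) < (E i).supp.card := by linarith
    have h4 : 1 < (E i).supp.card := by exact_mod_cast h3
    omega
  -- two distinct clauses with negative literals
  set i₀ : Fin m := ⟨0, by omega⟩
  set i₁ : Fin m := ⟨1, by omega⟩
  have h01 : i₀ ≠ i₁ := by simp [i₀, i₁, Fin.ext_iff]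
  obtain ⟨D₀, hD₀, hneg₀, hfst₀⟩ := exists_neg_clause_of_two_le_card (hcard i₀)
  obtain ⟨D₁, hD₁, hneg₁, hfst₁⟩ := exists_neg_clause_of_two_le_card (hcard i₁)
  have hD01 : D₀ ≠ D₁ := by
    intro heq
    have hV : eqVars 1 (E i₀) = eqVars 1 (E i₁) := by rw [← hfst₀, ← hfst₁, heq]
    refine supp_ne_of_expander E hℓ hr hexp h01 (Finset.ext fun j => ?_)
    rw [mem_supp_iff_val_mem_eqVars, mem_supp_iff_val_mem_eqVars, hV]
  have hmem : ∀ {D} (i), D ∈ equationCNF 1 (E i) → D ∈ sumEncoding 1 E := fun i hD => by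
    simp only [sumEncoding, List.mem_flatMap, List.mem_finRange, true_and]
    exact ⟨i, hD⟩
  have hD₀' := hmem i₀ hD₀
  have hD₁' := hmem i₁ hD₁
  cases hL : sumEncoding 1 E with
  | nil => simp [hL] at hD₀'
  | cons C φ =>
    rw [hL] at hD₀' hD₁'
    refine ⟨C, φ, rfl, ?_⟩
    rcases List.mem_cons.1 hD₀' with rfl | h₀
    · rcases List.mem_cons.1 hD₁' with h₁ | h₁
      · exact absurd h₁.symm hD01
      · exact ⟨D₁, h₁, hneg₁⟩
    · exact ⟨D₀, h₀, hneg₀⟩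

/-- **No `textbookFrege` proof of alternation depth `≤ 6` refutes the XOR-CNF of an `ℓ`-sparse,
`(r, 3/4·ℓ)`-boundary-expanding (`r ≥ 2`), unsolvable system over `𝔽₂`.** [folklore] -/
theorem not_isDepthProofOf_of_le_six {d : ℕ} (hℓ : 1 ≤ ℓ) (hr : 2 ≤ r) (hd : d ≤ 6)
    (hsparse : ∀ i, (E i).supp.card ≤ ℓ)
    (hexp : IsBoundaryExpander (fun i => (E i).supp.map Fin.valEmbedding) r (3 / 4 * ℓ))
    (hunsat : ¬ SystemSat E Finset.univ) (π : List (PropForm ℕ)) :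
    ¬ textbookFrege.IsDepthProofOf d π (neg (ofCNF (sumEncoding 1 E))) := by
  intro h
  obtain ⟨C, φ, hL, hφ⟩ := exists_neg_clause_tail E hℓ hr hsparse hexp hunsat
  rw [hL] at h
  have := seven_le_of_isDepthProofOf_neg_ofCNF hφ h
  omega

end System

/-! ### Part 5. The `d ≤ 6` slice of the crux, and the reduction of the crux to `d ≥ 7` -/

/-- The threshold: for `n ≥ ⌈2^{1/(1-δ)}⌉` the expansion scale `n^{1-δ}` is at least `2`.
[folklore] -/
theorem two_le_rpow_of_ceil_le {δ : ℝ} (hδ : δ < 1) {n : ℕ} (hn : ⌈(2 : ℝ) ^ (1 / (1 - δ))⌉₊ ≤ n) :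
    (2 : ℝ) ≤ (n : ℝ) ^ (1 - δ) := by
  have h1δ : 0 < 1 - δ := by linarith
  have hy : (2 : ℝ) ^ (1 / (1 - δ)) ≤ n := (Nat.le_ceil _).trans (by exact_mod_cast hn)
  calc (2 : ℝ) = ((2 : ℝ) ^ (1 / (1 - δ))) ^ (1 - δ) := by
        rw [← Real.rpow_mul (by norm_num), one_div, inv_mul_cancel₀ h1δ.ne', Real.rpow_one]
    _ ≤ (n : ℝ) ^ (1 - δ) := Real.rpow_le_rpow (by positivity) hy h1δ.le

/-- **The `d ≤ 6` slice of `LinearGeneratorDepthFregeHard` holds** (vacuously: with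
`N = ⌈2^{1/(1-δ)}⌉` there is no depth-`≤ 6` `textbookFrege` proof of `¬ ofCNF (sumEncoding 1 E)`
for any `ℓ`-sparse `(n^{1-δ}, 3/4·ℓ)`-boundary-expanding unsolvable `E`, `n ≥ N`). The statement
is the route decl `Summit.PneNP.PneNP.Theses.ExpanderLinearGenerators.LinearGeneratorDepthFregeHard`
with the extra hypothesis `d ≤ 6`. [folklore] -/
theorem linearGeneratorDepthFregeHard_depth_le_six :
    ∀ (ℓ d : ℕ) (δ : ℝ), 1 ≤ ℓ → 0 < δ → δ < 1 → d ≤ 6 → ∃ ε : ℝ, 0 < ε ∧ ∃ N : ℕ, ∀ n : ℕ, N ≤ n →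
      ∀ (m : ℕ) (E : Fin m → Literature.Computability.MetaComplexity.LinEqMod 2 n),
        (∀ i, (E i).supp.card ≤ ℓ) →
        Literature.Computability.MetaComplexity.IsBoundaryExpander
          (fun i => (E i).supp.map Fin.valEmbedding) ((n : ℝ) ^ (1 - δ)) (3 / 4 * ℓ) →
        ¬ Literature.Computability.MetaComplexity.SystemSat E Finset.univ →
        ∀ π : List (Literature.Computability.Complexity.PropForm ℕ),
          Literature.Computability.MetaComplexity.textbookFrege.IsDepthProofOf d π
            (Literature.Computability.Complexity.PropForm.neg
              (Literature.Computability.Complexity.PropForm.ofCNF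
                (Literature.Computability.MetaComplexity.sumEncoding 1 E))) →
          (2 : ℝ) ^ ((n : ℝ) ^ ε) ≤ (Literature.Computability.MetaComplexity.proofSize π : ℝ) := by
  intro ℓ d δ hℓ _hδ hδ1 hd
  refine ⟨1, one_pos, ⌈(2 : ℝ) ^ (1 / (1 - δ))⌉₊, fun n hn m E hsparse hexp hunsat π hπ => ?_⟩
  exact absurd hπ
    (not_isDepthProofOf_of_le_six E hℓ (two_le_rpow_of_ceil_le hδ1 hn) hd hsparse hexp hunsat π)

open Summit.PneNP.PneNP.Theses.ExpanderLinearGenerators in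
/-- **Reduction of the crux to depth `≥ 7`.** Item stmt-PneNP-11443
(`LinearGeneratorDepthFregeHard`, Krajíček's Problem 19.4.5 in universal-expander form) is
equivalent to its restriction to depths `d ≥ 7`; the depths `d ≤ 6` are settled by
`linearGeneratorDepthFregeHard_depth_le_six`. [folklore] -/
theorem linearGeneratorDepthFregeHard_iff_seven_le :
    LinearGeneratorDepthFregeHard ↔
    ∀ (ℓ d : ℕ) (δ : ℝ), 1 ≤ ℓ → 0 < δ → δ < 1 → 7 ≤ d → ∃ ε : ℝ, 0 < ε ∧ ∃ N : ℕ, ∀ n : ℕ, N ≤ n →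
      ∀ (m : ℕ) (E : Fin m → Literature.Computability.MetaComplexity.LinEqMod 2 n),
        (∀ i, (E i).supp.card ≤ ℓ) →
        Literature.Computability.MetaComplexity.IsBoundaryExpander
          (fun i => (E i).supp.map Fin.valEmbedding) ((n : ℝ) ^ (1 - δ)) (3 / 4 * ℓ) →
        ¬ Literature.Computability.MetaComplexity.SystemSat E Finset.univ →
        ∀ π : List (Literature.Computability.Complexity.PropForm ℕ),
          Literature.Computability.MetaComplexity.textbookFrege.IsDepthProofOf d π
            (Literature.Computability.Complexity.PropForm.neg
              (Literature.Computability.Complexity.PropForm.ofCNF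
                (Literature.Computability.MetaComplexity.sumEncoding 1 E))) →
          (2 : ℝ) ^ ((n : ℝ) ^ ε) ≤ (Literature.Computability.MetaComplexity.proofSize π : ℝ) := by
  refine ⟨fun h ℓ d δ hℓ hδ hδ1 _ => h ℓ d δ hℓ hδ hδ1, fun h ℓ d δ hℓ hδ hδ1 => ?_⟩
  by_cases hd : 7 ≤ d
  · exact h ℓ d δ hℓ hδ hδ1 hd
  · exact linearGeneratorDepthFregeHard_depth_le_six ℓ d δ hℓ hδ hδ1 (by omega)

end Summit.PneNP.PneNP.Theorems
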